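import Literature.AnabelianGeometry.EtaleTheta.TemperedFrobenioidOfGaloisCoveringZTower
import HarnessLib

/-!
# [EtTh] Thm. 4.4: `Thm44Hyp` INHABITED at the ℤ-tower data with TRIVIAL character over the genuine connected base
# `B^temp(Π^tp_X)⁰` — `Φ(A) ≅ (∏_ℤ ℤ_{≥0})^pf` of INFINITE rank, `Φ^{bs-fld} ⊊ Φ` (class (b) NV)

S. Mochizuki, *The étale theta function …*, Publ. RIMS **45** (2009) [MochizukiEtTh2009], Def. 3.3 (iii) p.73, Def. 3.6 (ii)
p.76–77, Def. 4.1 p.86–87, Thm. 4.4 p.93–95 [cite: MochizukiEtTh2009, Thm 4.4 p.93]; [FrdI] Def. 1.1 (i) p.19.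

abc-iut cell, layer L2 [EtTh], seat abc-iut-w5-d179 (gen 6), L2-lead row R505, FILE 3 part B.  Part A
(`TemperedFrobenioidOfGaloisCoveringZTower.lean`) built, for every tempered arithmetic group `X` and every character
`φ : Π^tp_X →* ℤ`, the tempered Frobenioid `ZTowerTempered.temperedFrobenioid X φ R S` of the ℤ-tower over `B^temp(Π^tp_X)⁰`
and its §4 setting.  The §4 hypothesis record `BiKummerSetting.Thm44Hyp` asks `Φ` to be NON-DILATING along EVERY endomorphism
of every connected tempered covering ([FrdI] Def. 1.1 (i)); along a deck transformation `g` the pull-back TRANSLATES the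
coordinates by `φ g`.  THIS FILE treats the case `φ = 1` (the tempered group acting trivially on the chain), where every
pull-back along an endomorphism is the identity (`ZTower.phiZeroPull_eq_of_forall_eq_one`: an equivariant family on ONE orbit
with values in a trivially acted-on target is constant) — while `Φ₀(A) = Div⁺(Z_∞) = ∏_ℤ ℤ_{≥0}` at EVERY covering (infinite
rank, the weak-vocabulary regime F-L2d2-1):
* `ZTower.delta φ S hφ ∈ Φ₀(S)` — the single component `[F_0]` as a constant family (legitimate iff `φ = 1`), with
  `delta^a ≠ diag^c` (`a ≠ 0`): so **`Φ^{bs-fld}(A) = ι(⟨diag⟩^pf) ⊊ Φ(A)`** (`ZTowerTempered.exists_mem_Φ_not_mem_bsFld`) — Def. 3.6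
  (ii)(a) holds as a PROPER-submonoid condition at constructed data for the first time in the tree;
* **`ZTowerTempered.thm44Hyp X R S NH M : Thm44Hyp (setting X 1 …) (setting X 1 …)`** — the identity self-equivalence (`Φ`
  non-dilating: pull-backs are the identity; `baseShape` with `𝒟 := Π/Π`; `H_⊙` open; `comm` by unitors);
* FIRING this lineage's closers BY NAME at these data: `thm44_i_zTower` (Thm. 4.4 (i) ⇐ {hBD₁, hBD₂}), `thm44_zTower_trivNH` /
  `thm44_zTower_rootsNH` ((i) ∧ (ii) ∧ (iii) ∧ N-th roots at the trivial / ROOTS reading of the `(N, H)`-slot).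
The genuine-translation case `φ ≠ 1` needs «a translation of `∏_{ℤ/N} ℤ_{≥0}` is non-dilating» ([FrdI] Def. 1.1 (i): the
primary ray `e_j` is carried OFF itself, so the dilation hypothesis fails unless the translation is trivial) — sequel.
HONEST FRAMING: class (b) NV; a legitimate but geometrically degenerate action (trivial character) on a combinatorial model;
`LogDivisorModel` / `GaloisAction` / `TemperedArithmeticGroup` are interface records; 3 defs (`ZTower.indicator0`, `ZTower.delta`,
`ZTowerTempered.thm44Hyp`) + 3 abbrevs; no Prop fact, no instance, no sorry; nothing here bears on [IUTchIII] Cor. 3.12;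
typed ≠ proved.
-/

noncomputable section

namespace Literature.AnabelianGeometry.EtaleTheta

open CategoryTheory Opposite Function Literature.AlgebraicGeometry.Frobenioids
  Literature.AnabelianGeometry.SemiGraphs LogDivisorModel LogDivisorModel.GaloisAction

/-! ## §1 The ℤ-tower under a character with `φ g = 1`: pull-backs are the identity; the single component `[F_0]` -/

namespace LogDivisorModel.ZTower

open TateTower

variable {Γ : Type} [Group Γ] (φ : Γ →* Multiplicative ℤ) (S : Action (Type 0) Γ)

/-- An element acting through `φ g = 1` fixes every log-divisor. [cite: MochizukiEtTh2009, Def 3.3 p.73] -/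
theorem actDIV_eq_of_apply_eq_one {g : Γ} (hg : φ g = 1) (d : model.DIV) : (action φ).actDIV g d = d :=
  ext_mlt fun x => by
    rcases x with c | n
    · exact c.elim
    · rw [mlt_actDIV_inr, hg, toAdd_one, sub_zero]

variable {S} in
/-- Under a trivial character an element of `Φ₀(S)`, `S` connected, is a CONSTANT family (an equivariant map from one orbit to a
trivially acted-on target). [cite: MochizukiEtTh2009, Rmk 3.3.1 p.73] -/
theorem apply_eq_apply_of_forall_eq_one (hφ : ∀ g, φ g = 1) (hS : isConnectedGSet S) (ψ : (action φ).phiZero S) (s t : S.V) :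
    ψ.1 s = ψ.1 t := by
  obtain ⟨g, rfl⟩ := ((isConnectedGSet_iff S).1 hS).2 s t
  rw [ψ.2.2 g s, actDIV_eq_of_apply_eq_one φ (hφ g)]

variable {S} in
/-- **Under a trivial character every endomorphism of a connected covering pulls `Φ₀` back IDENTICALLY.**
[cite: MochizukiFrdI2008, Def. 1.1 (i) p.19] -/
theorem phiZeroPull_eq_of_forall_eq_one (hφ : ∀ g, φ g = 1) (hS : isConnectedGSet S) (f : S ⟶ S) (ψ : (action φ).phiZero S) :
    (action φ).phiZeroPull f ψ = ψ :=
  Subtype.ext (funext fun _ => apply_eq_apply_of_forall_eq_one φ hφ hS ψ _ _)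

/-- The single component `[F_0]` of the chain as a log-divisor. [cite: MochizukiEtTh2009, Def 3.1 p.70] -/
def indicator0 : model.DIV := Multiplicative.ofAdd (α := TateTower.Idx → ℤ) fun x => if x = Sum.inr 0 then 1 else 0

/-- Multiplicities of `[F_0]`. [cite: MochizukiEtTh2009, Def 3.1 p.70] -/
theorem mlt_indicator0 (x : TateTower.Idx) : mlt indicator0 x = if x = Sum.inr 0 then 1 else 0 := rfl

/-- `[F_0]` has multiplicity `1` along `F_0`. [cite: MochizukiEtTh2009, Def 3.1 p.70] -/
theorem mlt_indicator0_zero : mlt indicator0 (Sum.inr 0) = 1 := by rw [mlt_indicator0, if_pos rfl]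

/-- `[F_0]` has multiplicity `0` along `F_1`. [cite: MochizukiEtTh2009, Def 3.1 p.70] -/
theorem mlt_indicator0_one : mlt indicator0 (Sum.inr 1) = 0 := by
  rw [mlt_indicator0, if_neg (fun h => one_ne_zero (Sum.inr_injective h))]

/-- `[F_0]` is an effective Cartier log-divisor. [cite: MochizukiEtTh2009, Def 3.1 p.70] -/
theorem indicator0_mem_Divplus : indicator0 ∈ model.Divplus :=
  mem_Divplus_of_nonneg fun x => by
    rw [mlt_indicator0]
    split_ifs
    · exact zero_le_one
    · exact le_rfl

/-- **`delta ∈ Φ₀(S)`**: the constant family `s ↦ [F_0]` — equivariant because the character is trivial.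
[cite: MochizukiEtTh2009, Def 3.3 p.73] -/
def delta (hφ : ∀ g, φ g = 1) : (action φ).phiZero S :=
  ⟨fun _ => indicator0, fun _ => indicator0_mem_Divplus, fun g _ => (actDIV_eq_of_apply_eq_one φ (hφ g) _).symm⟩

/-- The coordinate `(s, 0)` of `delta` is `1`. [cite: MochizukiEtTh2009, Def 3.1 p.70] -/
theorem coord_delta_zero (hφ : ∀ g, φ g = 1) (s : S.V) : coord φ S s 0 (delta φ S hφ) = Multiplicative.ofAdd 1 := by
  rw [coord_apply]
  exact congrArg _ (by rw [show (delta φ S hφ).1 s = indicator0 from rfl, mlt_indicator0_zero]; rfl)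

/-- The coordinate `(s, 1)` of `delta` is `0`. [cite: MochizukiEtTh2009, Def 3.1 p.70] -/
theorem coord_delta_one (hφ : ∀ g, φ g = 1) (s : S.V) : coord φ S s 1 (delta φ S hφ) = 1 := by
  rw [coord_apply, show (delta φ S hφ).1 s = indicator0 from rfl, mlt_indicator0_one, Int.toNat_zero, ofAdd_zero]

/-- **No positive power of `delta` is a power of the diagonal** (`S` nonempty): `Φ₀(S)` has rank `> 1`.
[cite: MochizukiEtTh2009, Def 3.6 p.77] -/
theorem delta_pow_ne_diag_pow (hφ : ∀ g, φ g = 1) (s : S.V) {a : ℕ} (ha : a ≠ 0) (c : ℕ) :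
    delta φ S hφ ^ a ≠ diag φ S ^ c := fun h => by
  have h1 : coord φ S s 1 (delta φ S hφ ^ a) = coord φ S s 1 (diag φ S ^ c) := congrArg (fun ψ => coord φ S s 1 ψ) h
  rw [coord_diag_pow, map_pow, coord_delta_one, one_pow] at h1
  have hc : c = 0 := ofAdd_eq_one.mp h1.symm
  have h0 : coord φ S s 0 (delta φ S hφ ^ a) = coord φ S s 0 (diag φ S ^ c) := congrArg (fun ψ => coord φ S s 0 ψ) h
  rw [coord_diag_pow, map_pow, coord_delta_zero, hc, ← ofAdd_nsmul, smul_eq_mul, mul_one] at h0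
  exact ha (Multiplicative.ofAdd.injective h0)

end LogDivisorModel.ZTower

/-! ## §2 `Thm44Hyp` at the ℤ-tower with trivial character, and the Thm. 4.4 closers -/

namespace ZTowerTempered

variable {K : Type} [Field K] (X : SemiGraphs.TemperedArithmeticGroup.{0} K)

/-- The trivial character `Π^tp_X → ℤ`. [cite: MochizukiEtTh2009, Def 3.3 p.73] -/
abbrev trivChar : X.Pi →* Multiplicative ℤ := 1

variable (R S : ((ConnectedPart (BTemp X.Pi))ᵒᵖ ⥤ CommMonCat.{0}) → Prop)

/-- **`Φ` is non-dilating along every endomorphism of the base** at the trivial character (pull-backs are the identity).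
[cite: MochizukiFrdI2008, Def. 1.1 (i) p.19] -/
theorem isNonDilating_trivChar (A : (ConnectedPart (BTemp X.Pi))ᵒᵖ) (α : A ⟶ A) :
    treeMonoidVocabWeak.{0}.IsNonDilating ((temperedFrobenioid X (trivChar X) R S).Φ.carrier A)
      ((temperedFrobenioid X (trivChar X) R S).Φ.pull α) :=
  isNonDilating_of_trivial X (trivChar X) R S A α fun m =>
    ZTower.phiZeroPull_eq_of_forall_eq_one (trivChar X) (fun _ => rfl) (isConnectedGSet_gset X _) _ m

/-- **`Φ^{bs-fld}(A) ⊊ Φ(A)`**: the class of the single component `delta` lies in `Φ(A)` but not in `ι(⟨diag⟩^pf) = Φ^{bs-fld}(A)` —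
Def. 3.6 (ii)(a) as a PROPER-submonoid condition at constructed data. [cite: MochizukiEtTh2009, Def 3.6 p.77] -/
theorem exists_mem_Φ_not_mem_bsFld (A : (ConnectedPart (BTemp X.Pi))ᵒᵖ) :
    ∃ x ∈ (temperedFrobenioid X (trivChar X) R S).Φ.carrier A, x ∉ (temperedFrobenioid X (trivChar X) R S).bsFld.carrier A := by
  have hM := hpf X (trivChar X) (op ((OneCompTempered.equiv X).inverse.obj A.unop))
  obtain ⟨s₀⟩ := (isConnectedGSet_gset X A.unop).1
  refine ⟨hM.weak.toRealification (Perfection.of _ (ZTower.delta (trivChar X) (gset X A.unop) fun _ => rfl)), ⟨_, rfl⟩, ?_⟩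
  rw [temperedFrobenioid_bsFld_carrier]
  rintro ⟨b, hb⟩
  obtain ⟨⟨c, n⟩, rfl⟩ := Perfection.mk_surjective b
  have h1 : Perfection.mk (ZTower.diag (trivChar X) (gset X A.unop) ^ Multiplicative.toAdd c) n =
      Perfection.mk (ZTower.delta (trivChar X) (gset X A.unop) fun _ => rfl) 1 :=
    PfImageWeak.toRealification_injective hM.weak hb
  obtain ⟨N, hN⟩ := Perfection.mk_eq_mk_iff.mp h1
  rw [← pow_mul, PNat.one_coe, mul_one] at hN
  exact ZTower.delta_pow_ne_diag_pow (trivChar X) (gset X A.unop) (fun _ => rfl) s₀ (Nat.mul_ne_zero N.ne_zero n.ne_zero) _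
    hN.symm

variable (NH : Subgroup (Field.absoluteGaloisGroup K) → (temperedFrobenioid X (trivChar X) R S).category → ℕ+ → Prop)
  (M : OpenNormalSubgroup X.Pi)

/-- **`Thm44Hyp` INHABITED at the ℤ-tower data (trivial character) over `B^temp(Π^tp_X)⁰`**: the identity self-equivalence.
[cite: MochizukiEtTh2009, Thm 4.4 p.93] -/
def thm44Hyp : BiKummerSetting.Thm44Hyp (setting X (trivChar X) R S NH M) (setting X (trivChar X) R S NH M) where
  isNonDilating₁ A α := isNonDilating_trivChar X R S A α
  isNonDilating₂ A α := isNonDilating_trivChar X R S A α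
  baseShape₁ := baseShape X (trivChar X) R S
  baseShape₂ := baseShape X (trivChar X) R S
  isOpen_Hodot₁ := BiKummerSetting.isOpen_Hodot_mkOfConnectedTemperoid X _ _ _ NH _ _ _
  isOpen_Hodot₂ := BiKummerSetting.isOpen_Hodot_mkOfConnectedTemperoid X _ _ _ NH _ _ _
  Ψ := CategoryTheory.Equivalence.refl
  Ψbs := CategoryTheory.Equivalence.refl
  comm := (setting X (trivChar X) R S NH M).base.rightUnitor ≪≫ (setting X (trivChar X) R S NH M).base.leftUnitor.symm
  mapsAodot := ⟨Iso.refl _⟩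

/-- **Non-vacuity of `Thm44Hyp` at the ℤ-tower data** (every `X`, `M`, `NH`, `R`, `S`). [cite: MochizukiEtTh2009, Thm 4.4 p.93] -/
theorem nonempty_thm44Hyp :
    Nonempty (BiKummerSetting.Thm44Hyp (setting X (trivChar X) R S NH M) (setting X (trivChar X) R S NH M)) :=
  ⟨thm44Hyp X R S NH M⟩

/-- **[EtTh] Thm. 4.4 (i) FIRES at the ℤ-tower data, for EVERY `(N, H)`-slot** — this lineage's
`thm44_i_mkOfConnectedTemperoid_of_baseInj_treeVocabWeak` (⇐ {hBD₁, hBD₂}). [cite: MochizukiEtTh2009, Thm 4.4 (i) p.94] -/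
theorem thm44_i_zTower : BiKummerSetting.Thm44_i (thm44Hyp X R S NH M) :=
  (thm44Hyp X R S NH M).thm44_i_mkOfConnectedTemperoid_of_baseInj_treeVocabWeak _ _ _ NH _ _ _ _ _ _ NH _ _ _
    (fun α => hBD X (trivChar X) R S α) fun α => hBD X (trivChar X) R S α

/-- T44-L03 at the identity (from `hBD`). [cite: MochizukiEtTh2009, Thm 4.4 p.95] -/
theorem thm44Hyp_preservesFrobeniusStructure : (thm44Hyp X R S NH M).PreservesFrobeniusStructure :=
  (thm44Hyp X R S NH M).preservesFrobeniusStructure_mkOfConnectedTemperoid_of_baseInj_treeVocabWeak _ _ _ NH _ _ _ _ _ _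
    NH _ _ _ (fun α => hBD X (trivChar X) R S α) fun α => hBD X (trivChar X) R S α

/-- The `ψ`-slot of Thm. 4.4 (ii)(iii): this lineage's `psiModel` at the identity. [cite: MochizukiEtTh2009, Thm 4.4 p.94] -/
abbrev ψ (A : (setting X (trivChar X) R S NH M).C) :
    (setting X (trivChar X) R S NH M).biratUnits A ≃*
      (setting X (trivChar X) R S NH M).biratUnits ((thm44Hyp X R S NH M).Ψ.functor.obj A) :=
  (thm44Hyp X R S NH M).psiModel (isFrobenioid_temperedFrobenioid X _ R S) (isFrobenioid_temperedFrobenioid X _ R S)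
    (thm44Hyp_preservesFrobeniusStructure X R S NH M) A

end ZTowerTempered

namespace ZTowerTempered

variable {K : Type} [Field K] (X : SemiGraphs.TemperedArithmeticGroup.{0} K)
  (R S : ((ConnectedPart (BTemp X.Pi))ᵒᵖ ⥤ CommMonCat.{0}) → Prop) (M : OpenNormalSubgroup X.Pi)

/-- The TRIVIAL `(N, H)`-slot (`True`). [cite: MochizukiEtTh2009, Def 4.1 p.87] -/
abbrev trivNH : Subgroup (Field.absoluteGaloisGroup K) → (temperedFrobenioid X (trivChar X) R S).category → ℕ+ → Prop :=
  fun _ _ _ => True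

/-- T44-L15b at the identity with the trivial `(N, H)`-slot: tautological. [cite: MochizukiEtTh2009, Thm 4.4 p.95] -/
theorem thm44Hyp_preservesNHSaturatedBsFld_trivNH : (thm44Hyp X R S (trivNH X R S) M).PreservesNHSaturatedBsFld :=
  fun _ _ _ _ _ => Iff.rfl

/-- **[EtTh] Thm. 4.4 (i) ∧ (ii) ∧ (iii)-saturation ∧ N-th roots FIRE at the ℤ-tower data** (trivial `(N, H)`-slot) — this lineage's
`thm44_mkOfConnectedTemperoid_of_baseInj_treeVocabWeak'` (⇐ {hBD₁, hBD₂, T44-L15b}, all three PROVED here).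
[cite: MochizukiEtTh2009, Thm 4.4 p.94] -/
theorem thm44_zTower_trivNH :
    BiKummerSetting.Thm44_i (thm44Hyp X R S (trivNH X R S) M) ∧
      BiKummerSetting.Thm44_ii (thm44Hyp X R S (trivNH X R S) M) (ψ X R S (trivNH X R S) M) ∧
      BiKummerSetting.Thm44_iii (thm44Hyp X R S (trivNH X R S) M) (ψ X R S (trivNH X R S) M) ∧
      (thm44Hyp X R S (trivNH X R S) M).PreservesNthRoots (ψ X R S (trivNH X R S) M)
        (fun φ f => (temperedFrobenioid X (trivChar X) R S).pullFracModel φ f)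
        fun φ f => (temperedFrobenioid X (trivChar X) R S).pullFracModel φ f :=
  (thm44Hyp X R S (trivNH X R S) M).thm44_mkOfConnectedTemperoid_of_baseInj_treeVocabWeak' _ _ _ _ _ _ _ _ _ _ _ _ _ _
    (fun α => hBD X (trivChar X) R S α) (fun α => hBD X (trivChar X) R S α) (thm44Hyp_preservesNHSaturatedBsFld_trivNH X R S M)

/-- The ROOTS READING of the `(N, H)`-slot (abc-iut-w4-d044): "every unit of `B(A_⊙)` with trivial divisor has an `M`-th root
over `A`". [cite: MochizukiEtTh2009, Def 4.1 p.87] -/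
abbrev rootsNH : Subgroup (Field.absoluteGaloisGroup K) → (temperedFrobenioid X (trivChar X) R S).category → ℕ+ → Prop :=
  fun _ A N => ∀ (g : A.base ⟶ ((temperedFrobenioid X (trivChar X) R S).connQuotZeroObj M).base)
    (x : (temperedFrobenioid X (trivChar X) R S).ratFnFunctor.obj
      (op ((temperedFrobenioid X (trivChar X) R S).connQuotZeroObj M).base)),
    divB (temperedFrobenioid X (trivChar X) R S).divisorMonoid (temperedFrobenioid X (trivChar X) R S).ratFnFunctor
        (temperedFrobenioid X (trivChar X) R S).divBNatTrans (op ((temperedFrobenioid X (trivChar X) R S).connQuotZeroObj M).base)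
        x = 1 →
      ∃ ζ : (temperedFrobenioid X (trivChar X) R S).ratFnFunctor.obj (op A.base),
        ζ ^ (N : ℕ) = pull (temperedFrobenioid X (trivChar X) R S).ratFnFunctor g x

/-- **[EtTh] Thm. 4.4 (i) ∧ (ii) ∧ (iii)-saturation ∧ N-th roots FIRE at the ℤ-tower data AT THE ROOTS READING** of the
`(N, H_⊙^{bs-fld})`-slot — this lineage's `thm44_mkOfConnectedTemperoid_rootsReading_of_baseInj_treeVocabWeak` (⇐ {hBD₁, hBD₂};
T44-L15b by abc-iut-w4-d044's `preservesNHSaturatedBsFld_rootsReading`). [cite: MochizukiEtTh2009, Thm 4.4 p.94] -/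
theorem thm44_zTower_rootsNH :
    BiKummerSetting.Thm44_i (thm44Hyp X R S (rootsNH X R S M) M) ∧
      BiKummerSetting.Thm44_ii (thm44Hyp X R S (rootsNH X R S M) M) (ψ X R S (rootsNH X R S M) M) ∧
      BiKummerSetting.Thm44_iii (thm44Hyp X R S (rootsNH X R S M) M) (ψ X R S (rootsNH X R S M) M) ∧
      (thm44Hyp X R S (rootsNH X R S M) M).PreservesNthRoots (ψ X R S (rootsNH X R S M) M)
        (fun φ f => (temperedFrobenioid X (trivChar X) R S).pullFracModel φ f)
        fun φ f => (temperedFrobenioid X (trivChar X) R S).pullFracModel φ f :=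
  (thm44Hyp X R S (rootsNH X R S M) M).thm44_mkOfConnectedTemperoid_rootsReading_of_baseInj_treeVocabWeak
    (temperedFrobenioid X (trivChar X) R S) rfl (hP X (trivChar X) R S) ((temperedFrobenioid X (trivChar X) R S).connQuotZeroObj M)
    ((temperedFrobenioid X (trivChar X) R S).isFrobeniusTrivial_connQuotZeroObj M)
    ((temperedFrobenioid X (trivChar X) R S).isGaloisObj_connQuotZeroObj_base M)
    (temperedFrobenioid X (trivChar X) R S) rfl (hP X (trivChar X) R S) ((temperedFrobenioid X (trivChar X) R S).connQuotZeroObj M)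
    ((temperedFrobenioid X (trivChar X) R S).isFrobeniusTrivial_connQuotZeroObj M)
    ((temperedFrobenioid X (trivChar X) R S).isGaloisObj_connQuotZeroObj_base M)
    (isFrobenioid_temperedFrobenioid X _ R S) (isFrobenioid_temperedFrobenioid X _ R S)
    (thm44Hyp_preservesFrobeniusStructure X R S _ M) (fun α => hBD X (trivChar X) R S α) fun α => hBD X (trivChar X) R S α

end ZTowerTempered

end Literature.AnabelianGeometry.EtaleTheta

end
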